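import Mathlib
import HarnessLib

/-!
# `DensityLadder.SeparatedTowerDensityLine` (item stmt-RiemannHypothesis-24918) — Gaussian mean
# values with complex rates (step (d) of stub S1)

LINE L57 «sieve sight above the density line» (rh-idea-10 g1), crux K1 `SeparatedTowerDensityLine`,
stub S1 of the registered skeleton `Birth.lean`, step (d) of the mean-value argument (seat memo
`MEANVALUE-SECOND-READ.md` on stmt-RiemannHypothesis-24918).  The mean square of the zero sum
`Σ_i b_i e^{ρ_i u}` in `u = log x` against the Gaussian `G_L(u−U) = e^{−(u−U)²/(2L²)}` is the double
sum of `b_i conj(b_j) Ĝ_{ij}`, `Ĝ_{ij} = ∫ e^{(ρ_i + conj ρ_j)u} G_L(u−U) du`.  This file evaluates the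
Gaussian integral with a complex rate, `∫ e^{zu} G_L(u−U) du = √(2π) L e^{zU + z²L²/2}`
(Mathlib `integral_cexp_quadratic`), its modulus `√(2π)L e^{sU + (s²−t²)L²/2}` (`z = s + it`), and
the off-diagonal domination `|Ĝ_{ij}| ≤ √(Ĝ_{ii}Ĝ_{jj}) e^{−(γ_i−γ_j)²L²/2}` in the exponent form
`(β_i+β_j)U + ((β_i+β_j)² − t²)L²/2 ≤ (β_iU + β_i²L²) + (β_jU + β_j²L²) − t²L²/2` (AM–GM).
Cell rh-split, seat rh-split-prover-l57 g0.  RH-free, ζ-free; FRONTIER bookkeeping; nothing here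
bears on the truth of RH.
-/

set_option linter.dupNamespace false

noncomputable section

open Complex Filter Set MeasureTheory Topology
open scoped Real

namespace Summit.RiemannHypothesis.RiemannHypothesis.Theorems.DensityLadderSeparatedTowerGaussian

/-- **Gaussian integral with a complex rate**: for `L > 0`, `U ∈ ℝ`, `z ∈ ℂ`,
`∫_ℝ e^{zu} e^{−(u−U)²/(2L²)} du = √(2π) L · e^{zU + z²L²/2}`. [folklore] -/
theorem integral_cexp_mul_gaussian (z : ℂ) {L : ℝ} (hL : 0 < L) (U : ℝ) :
    ∫ u : ℝ, cexp (z * u) * (Real.exp (-(u - U) ^ 2 / (2 * L ^ 2)) : ℂ) =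
      ((Real.sqrt (2 * π) * L : ℝ) : ℂ) * cexp (z * U + z ^ 2 * L ^ 2 / 2) := by
  -- rewrite the integrand as `exp (b u² + c u + d)`
  set b : ℂ := -(1 / (2 * (L : ℂ) ^ 2)) with hb
  set c : ℂ := z + (U : ℂ) / (L : ℂ) ^ 2 with hc
  set d : ℂ := -((U : ℂ) ^ 2) / (2 * (L : ℂ) ^ 2) with hd
  have hL0 : (L : ℂ) ≠ 0 := by exact_mod_cast hL.ne'
  have hbre : b.re < 0 := by
    rw [hb]
    have : (1 / (2 * (L : ℂ) ^ 2)) = ((1 / (2 * L ^ 2) : ℝ) : ℂ) := by push_cast; ring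
    rw [this, neg_re, Complex.ofReal_re, neg_lt_zero]
    positivity
  have hint : ∀ u : ℝ, cexp (z * u) * (Real.exp (-(u - U) ^ 2 / (2 * L ^ 2)) : ℂ) =
      cexp (b * u ^ 2 + c * u + d) := by
    intro u
    rw [Complex.ofReal_exp, ← Complex.exp_add]
    congr 1
    rw [hb, hc, hd]
    push_cast
    field_simp
    ring
  simp_rw [hint]
  rw [integral_cexp_quadratic hbre c d]
  -- identify the constants
  have h1 : (π / -b) ^ (1 / 2 : ℂ) = ((Real.sqrt (2 * π) * L : ℝ) : ℂ) := by
    have e : (π / -b : ℂ) = ((2 * π * L ^ 2 : ℝ) : ℂ) := by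
      rw [hb, neg_neg]; push_cast; field_simp
    rw [e, show (1 / 2 : ℂ) = ((1 / 2 : ℝ) : ℂ) by push_cast; ring,
      ← Complex.ofReal_cpow (by positivity), ← Real.sqrt_eq_rpow]
    congr 1
    rw [show (2 * π * L ^ 2 : ℝ) = (2 * π) * L ^ 2 by ring, Real.sqrt_mul (by positivity),
      Real.sqrt_sq hL.le]
  have h2 : d - c ^ 2 / (4 * b) = z * U + z ^ 2 * L ^ 2 / 2 := by
    rw [hb, hc, hd]
    field_simp
    ring
  rw [h1, h2]

/-- The modulus of the Gaussian mean value: `‖e^{zU + z²L²/2}‖ = e^{Re z · U + (Re z² − Im z²)L²/2}`.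
[folklore] -/
theorem norm_cexp_gaussMV (z : ℂ) (L U : ℝ) :
    ‖cexp (z * U + z ^ 2 * L ^ 2 / 2)‖ =
      Real.exp (z.re * U + (z.re ^ 2 - z.im ^ 2) * L ^ 2 / 2) := by
  rw [Complex.norm_exp]
  congr 1
  have h2 : (z ^ 2 * (L : ℂ) ^ 2 / 2).re = (z.re ^ 2 - z.im ^ 2) * L ^ 2 / 2 := by
    rw [Complex.div_ofNat_re]
    congr 1
    rw [Complex.mul_re, ← Complex.ofReal_pow, Complex.ofReal_re, Complex.ofReal_im, mul_zero,
      sub_zero, sq, Complex.mul_re]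
    ring
  rw [Complex.add_re, h2, Complex.mul_re, Complex.ofReal_re, Complex.ofReal_im, mul_zero, sub_zero]

/-- **Off-diagonal domination (AM–GM in the exponent)**: for real `β₁, β₂, t, U` and `L`,
`(β₁+β₂)U + ((β₁+β₂)² − t²)L²/2 ≤ (β₁U + β₁²L²) + (β₂U + β₂²L²) − t²L²/2`, i.e.
`|Ĝ_{ij}| ≤ √(Ĝ_{ii}Ĝ_{jj}) · e^{−t²L²/2}` for the Gaussian mean values of `e^{ρ_i u}`, `e^{ρ_j u}`
(`ρ = β + iγ`, `t = γ_i − γ_j`; `√(Ĝ_{ii}Ĝ_{jj}) = √(2π)L e^{(β_i+β_j)U + (β_i²+β_j²)L²}`). [folklore] -/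
theorem offDiag_exponent_le (β₁ β₂ t U L : ℝ) :
    (β₁ + β₂) * U + ((β₁ + β₂) ^ 2 - t ^ 2) * L ^ 2 / 2 ≤
      (β₁ * U + β₁ ^ 2 * L ^ 2) + (β₂ * U + β₂ ^ 2 * L ^ 2) - t ^ 2 * L ^ 2 / 2 := by
  nlinarith [sq_nonneg (β₁ - β₂), sq_nonneg L, mul_nonneg (sq_nonneg (β₁ - β₂)) (sq_nonneg L)]

/-- The same in multiplicative form: with `z = (β₁ + β₂) + it`,
`‖e^{zU + z²L²/2}‖ ≤ e^{β₁U + β₁²L²} · e^{β₂U + β₂²L²} · e^{−t²L²/2}`. [folklore] -/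
theorem norm_cexp_gaussMV_offDiag_le (β₁ β₂ t U L : ℝ) :
    ‖cexp ((((β₁ + β₂ : ℝ) : ℂ) + t * I) * U + (((β₁ + β₂ : ℝ) : ℂ) + t * I) ^ 2 * L ^ 2 / 2)‖ ≤
      Real.exp (β₁ * U + β₁ ^ 2 * L ^ 2) * Real.exp (β₂ * U + β₂ ^ 2 * L ^ 2) *
        Real.exp (-(t ^ 2 * L ^ 2 / 2)) := by
  rw [norm_cexp_gaussMV, ← Real.exp_add, ← Real.exp_add, Real.exp_le_exp]
  have hre : ((((β₁ + β₂ : ℝ) : ℂ) + t * I)).re = β₁ + β₂ := by simp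
  have him : ((((β₁ + β₂ : ℝ) : ℂ) + t * I)).im = t := by simp
  rw [hre, him]
  have := offDiag_exponent_le β₁ β₂ t U L
  linarith

/-- The diagonal value: with `z = 2β` real, `‖e^{zU + z²L²/2}‖ = e^{2βU + 2β²L²}`. [folklore] -/
theorem norm_cexp_gaussMV_diag (β U L : ℝ) :
    ‖cexp ((((2 * β : ℝ) : ℂ)) * U + (((2 * β : ℝ) : ℂ)) ^ 2 * L ^ 2 / 2)‖ =
      Real.exp (2 * β * U + 2 * β ^ 2 * L ^ 2) := by
  rw [norm_cexp_gaussMV]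
  simp only [Complex.ofReal_re, Complex.ofReal_im]
  congr 1
  ring

/-! ## Mean square of a finite exponential sum against the Gaussian -/

/-- The Gaussian-damped exponential `e^{zu} e^{−(u−U)²/(2L²)}` is integrable on `ℝ`. [folklore] -/
theorem integrable_cexp_mul_gaussian (z : ℂ) {L : ℝ} (hL : 0 < L) (U : ℝ) :
    Integrable fun u : ℝ ↦ cexp (z * u) * (Real.exp (-(u - U) ^ 2 / (2 * L ^ 2)) : ℂ) := by
  set b : ℂ := -(1 / (2 * (L : ℂ) ^ 2)) with hb
  set c : ℂ := z + (U : ℂ) / (L : ℂ) ^ 2 with hc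
  set d : ℂ := -((U : ℂ) ^ 2) / (2 * (L : ℂ) ^ 2) with hd
  have hL0 : (L : ℂ) ≠ 0 := by exact_mod_cast hL.ne'
  have hbre : b.re < 0 := by
    rw [hb]
    have : (1 / (2 * (L : ℂ) ^ 2)) = ((1 / (2 * L ^ 2) : ℝ) : ℂ) := by push_cast; ring
    rw [this, neg_re, Complex.ofReal_re, neg_lt_zero]
    positivity
  have hint : ∀ u : ℝ, cexp (z * u) * (Real.exp (-(u - U) ^ 2 / (2 * L ^ 2)) : ℂ) =
      cexp (b * u ^ 2 + c * u + d) := by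
    intro u
    rw [Complex.ofReal_exp, ← Complex.exp_add]
    congr 1
    rw [hb, hc, hd]
    push_cast
    field_simp
    ring
  simp_rw [hint]
  exact integrable_cexp_quadratic' hbre c d

open scoped ComplexConjugate in
/-- **Mean square of a finite exponential sum against the Gaussian** (step (d) for finite
families; the zero sums of the line are truncated to finite height before averaging): for a finite
index set `F`, coefficients `b_i` and complex rates `ρ_i`,
`∫ |Σ_{i∈F} b_i e^{ρ_i u}|² e^{−(u−U)²/(2L²)} du = Σ_{i,j∈F} b_i conj(b_j) √(2π)L e^{z_{ij}U + z_{ij}²L²/2}`,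
`z_{ij} = ρ_i + conj ρ_j`. [folklore] -/
theorem integral_normSq_sum_mul_gaussian {ι : Type} (F : Finset ι) (b ρ : ι → ℂ) {L : ℝ}
    (hL : 0 < L) (U : ℝ) :
    ∫ u : ℝ, (((‖∑ i ∈ F, b i * cexp (ρ i * u)‖ ^ 2 : ℝ) : ℂ)) *
        (Real.exp (-(u - U) ^ 2 / (2 * L ^ 2)) : ℂ) =
      ∑ i ∈ F, ∑ j ∈ F, b i * conj (b j) * (((Real.sqrt (2 * π) * L : ℝ) : ℂ) *
        cexp ((ρ i + conj (ρ j)) * U + (ρ i + conj (ρ j)) ^ 2 * L ^ 2 / 2)) := by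
  -- pointwise expansion of `|S(u)|² G(u)`
  have hpt : ∀ u : ℝ, (((‖∑ i ∈ F, b i * cexp (ρ i * u)‖ ^ 2 : ℝ) : ℂ)) *
      (Real.exp (-(u - U) ^ 2 / (2 * L ^ 2)) : ℂ) =
      ∑ i ∈ F, ∑ j ∈ F, b i * conj (b j) *
        (cexp ((ρ i + conj (ρ j)) * u) * (Real.exp (-(u - U) ^ 2 / (2 * L ^ 2)) : ℂ)) := by
    intro u
    have hsq : (((‖∑ i ∈ F, b i * cexp (ρ i * u)‖ ^ 2 : ℝ) : ℂ)) =
        (∑ i ∈ F, b i * cexp (ρ i * u)) * conj (∑ i ∈ F, b i * cexp (ρ i * u)) := by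
      rw [Complex.mul_conj, Complex.normSq_eq_norm_sq, Complex.ofReal_pow]
    rw [hsq, map_sum, Finset.sum_mul_sum, Finset.sum_mul]
    refine Finset.sum_congr rfl fun i _ ↦ ?_
    rw [Finset.sum_mul]
    refine Finset.sum_congr rfl fun j _ ↦ ?_
    rw [map_mul, ← Complex.exp_conj, map_mul, Complex.conj_ofReal]
    have : cexp (ρ i * u) * cexp (conj (ρ j) * u) = cexp ((ρ i + conj (ρ j)) * u) := by
      rw [← Complex.exp_add]; ring_nf
    calc b i * cexp (ρ i * ↑u) * ((starRingEnd ℂ) (b j) * cexp ((starRingEnd ℂ) (ρ j) * ↑u)) *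
          ↑(Real.exp (-(u - U) ^ 2 / (2 * L ^ 2)))
        = b i * conj (b j) * ((cexp (ρ i * u) * cexp (conj (ρ j) * u)) *
          ↑(Real.exp (-(u - U) ^ 2 / (2 * L ^ 2)))) := by ring
      _ = _ := by rw [this]
  simp_rw [hpt]
  rw [integral_finsetSum _ fun i _ ↦ ?_]
  · refine Finset.sum_congr rfl fun i _ ↦ ?_
    rw [integral_finsetSum _ fun j _ ↦ ?_]
    · refine Finset.sum_congr rfl fun j _ ↦ ?_
      rw [integral_const_mul, integral_cexp_mul_gaussian _ hL U]
    · exact (integrable_cexp_mul_gaussian _ hL U).const_mul _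
  · exact integrable_finsetSum _ fun j _ ↦ (integrable_cexp_mul_gaussian _ hL U).const_mul _

end Summit.RiemannHypothesis.RiemannHypothesis.Theorems.DensityLadderSeparatedTowerGaussian

end
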